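import Summits.ResolutionOfSingularities.ResolutionOfSingularities.Theorems.PurelyInseparableDim4ResConeShearTransport
import Summits.ResolutionOfSingularities.ResolutionOfSingularities.Theorems.PurelyInseparableDim4Mode0UmbrellaSteps
import HarnessLib

/-!
# Purely inseparable four-folds — L-LIGHT KILL, part F2: ONE-SLICE BOOKKEEPING `(α_A, α_B, o)` UNDER A TWIN STEP AND THE CORNER-DYNAMICS
# TRICHOTOMY (cell `res-dim4-pi`, K2(p) lane, the open loss-free `e = 3` cell; seat res-dim4-p-9 g6; HOME-only under desk R-251)

[OURS · counted 0]  Nothing here proves any TAIL(p, d, 3), K2(7), K2(p) or resolution of singularities in dimension ≥ 4 /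
characteristic `p` — NOT proved.  Bookkeeping of OUR frame's point step on ONE `x_ν`-slice.  AI kernel work, weaker than expert review.

ONE SLICE, ONE TWIN STEP (memo `res-dim4-p-9/memo/L-LIGHT-KILL-g6.md` §3).  Letters: chart `j`, the other twin `i`, the free letter
`φ` (translation `t e_φ`, i.e. the shear `x_φ ↦ x_φ + t x_j`), the permanent letter `ν`.  `G` = one `x_ν^v`-slice (every monomial has
`ν`-exponent `v`), minimal degree `o ≥ p`, minimal `j`-exponent `≥ α_j`, minimal `i`-exponent `α_i` (attained).  The uncleaned child
`G′ = chartTransform p univ j (shear j (t e_φ) G)` has: every monomial with `ν`-exponent `v`, `j`-exponent `≥ o − p`, `i`-exponent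
`≥ α_i` (`slice_step_lower`); a monomial with `j`-exponent `= o − p` AND degree `≤ 2o − p − α_j` (`slice_step_top`: the top-`φ` monomial of
minimal degree survives the shear — so the cofactor order `e := o − α_A − α_B − v` NEVER INCREASES); a monomial with `i`-exponent `α_i`
(`slice_step_other`).  §3: a non-increasing `ℕ`-sequence is eventually constant; §4 THE TRICHOTOMY of the integer corner dynamics
`(u, v) ↦ (u + v, v)` / `(u, u + v)` with both moves beyond every time: stationary `(0,0)`, or `u + v → +∞`, given `u + v` bounded below.
[cite: Hauser2010, §§F–G, §I (P⁺)] [cite: HauserPerlega2019PRIMS, §2 (transform at a translated point)]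
[cite: CossartJannsenSaito2020, Lemma 13.2]
bears_on: LADDER-RESOLUTION:D157-DOOR2 (res-dim4-pi · K2(p) L-light cell · slice bookkeeping + trichotomy).  Supports
stmt-ResolutionOfSingularities-16155 (helper).
-/

set_option linter.dupNamespace false -- mandated namespace of this single-conjunct summit

noncomputable section

namespace Summit.ResolutionOfSingularities.ResolutionOfSingularities.Theorems.PIDim4

namespace ResCone

namespace LLight

open MvPolynomial Finset
open Literature.AlgebraicGeometry.Resolution
open Literature.AlgebraicGeometry.Resolution.CentreBlowup
open Literature.AlgebraicGeometry.Resolution.Hauser2010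

variable {K : Type} [Field K]

/-- (tool, private copy of F1's) the coefficient of a chart image. -/
private theorem coeff_cT_chartExponent {Q : ℕ} {j : Fin 4} {P : MvPolynomial (Fin 4) K}
    (hP : ∀ d ∈ P.support, Q ≤ d.degree) {e : Fin 4 →₀ ℕ} (he : Q ≤ e.degree) :
    coeff (chartExponent Q Finset.univ j e) (chartTransform Q Finset.univ j P) = coeff e P := by
  classical
  by_cases hes : e ∈ P.support
  · exact Mode0Umbrella.coeff_chartTransform_univ hP hes
  · rw [MvPolynomial.notMem_support_iff.mp hes]
    by_contra hne
    obtain ⟨d, hd, hde⟩ := Mode0Umbrella.exists_of_mem_support_chartTransform (MvPolynomial.mem_support_iff.mpr hne)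
    exact hes (Mode0Umbrella.chartExponent_univ_inj (hP d hd) he hde ▸ hd)

/-- The shear target exponent has the degree of its source. [folklore] -/
theorem degree_shear_target {j φ : Fin 4} (hjφ : j ≠ φ) (m : Fin 4 →₀ ℕ) {l : ℕ} (hl : l ≤ m φ) :
    ((m.update φ (m φ - l)).update j (m j + l)).degree = m.degree := by
  have h1 := PointBlowup.degree_update_add (m.update φ (m φ - l)) j (m j + l)
  have h2 := PointBlowup.degree_update_add m φ (m φ - l)
  rw [Finsupp.coe_update, Function.update_of_ne hjφ] at h1
  omega

/-- The canceller exponent has the degree of its source. [folklore] -/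
theorem degree_canceller {j φ : Fin 4} (hjφ : j ≠ φ) (m : Fin 4 →₀ ℕ) {l : ℕ} (hl : l ≤ m j) :
    ((m.update j (m j - l)).update φ (m φ + l)).degree = m.degree := by
  have h1 := PointBlowup.degree_update_add (m.update j (m j - l)) φ (m φ + l)
  have h2 := PointBlowup.degree_update_add m j (m j - l)
  rw [Finsupp.coe_update, Function.update_of_ne hjφ.symm] at h1
  omega

/-! ## 1. The top-`φ` monomial of a family survives the shear -/

/-- **A monomial with no canceller keeps its coefficient under the shear `x_φ ↦ x_φ + t x_j`**: if no monomial of `G` equals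
`m − l e_j + l e_φ` with `l ≥ 1`, then `coeff m (shear j (t e_φ) G) = coeff m G`. [folklore] [cite: Hauser2010, §I (P⁺)] -/
theorem coeff_shear_single_eq_self {j φ : Fin 4} (hjφ : j ≠ φ) (t : K) (G : MvPolynomial (Fin 4) K) {m : Fin 4 →₀ ℕ}
    (h : ∀ l, 1 ≤ l → l ≤ m j → coeff ((m.update j (m j - l)).update φ (m φ + l)) G = 0) :
    coeff m (Hauser2010.shear j (Pi.single φ t) G) = coeff m G := by
  rw [coeff_shear_single hjφ, Finset.sum_range_succ']
  have htail : ∑ l ∈ Finset.range (m j), ((m φ + (l + 1)).choose (l + 1) : K) * t ^ (l + 1) *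
      coeff ((m.update j (m j - (l + 1))).update φ (m φ + (l + 1))) G = 0 :=
    Finset.sum_eq_zero fun l hl => by rw [h (l + 1) (by omega) (by have := Finset.mem_range.mp hl; omega), mul_zero]
  rw [htail, zero_add, add_zero, Nat.choose_zero_right, Nat.cast_one, pow_zero, one_mul, one_mul, Nat.sub_zero,
    Finsupp.update_self, Finsupp.update_self]

/-- **The top-`φ` member of a family closed under cancellers survives**: if `m ∈ S ⊆ supp G` has maximal `φ`-exponent in `S` and every
canceller `m − l e_j + l e_φ` (`l ≥ 1`) that occurs in `G` would lie in `S`, then `coeff m (shear j (t e_φ) G) = coeff m G ≠ 0`.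
[folklore] -/
theorem coeff_shear_single_ne_zero_of_top {j φ : Fin 4} (hjφ : j ≠ φ) (t : K) (G : MvPolynomial (Fin 4) K)
    {S : Finset (Fin 4 →₀ ℕ)} (hS : S ⊆ G.support) {m : Fin 4 →₀ ℕ} (hm : m ∈ S) (htop : ∀ m' ∈ S, m' φ ≤ m φ)
    (hcanc : ∀ l, 1 ≤ l → l ≤ m j → (m.update j (m j - l)).update φ (m φ + l) ∈ G.support →
      (m.update j (m j - l)).update φ (m φ + l) ∈ S) :
    coeff m (Hauser2010.shear j (Pi.single φ t) G) ≠ 0 := by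
  rw [coeff_shear_single_eq_self hjφ t G]
  · exact MvPolynomial.mem_support_iff.mp (hS hm)
  · intro l hl1 hlj
    by_contra hne
    have hmem := hcanc l hl1 hlj (MvPolynomial.mem_support_iff.mpr hne)
    have := htop _ hmem
    rw [Finsupp.coe_update, Function.update_self] at this
    omega

/-! ## 2. One twin step on one slice: lower bounds, the surviving top monomial, the other twin's minimum -/

section Step

variable {p : ℕ} {j i φ ν : Fin 4} {G : MvPolynomial (Fin 4) K} {t : K} {v o αj αi : ℕ}

/-- **LOWER BOUNDS AFTER THE STEP**: every monomial of the uncleaned child `chartTransform p univ j (shear j (t e_φ) G)` has `ν`-exponent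
`v`, `j`-exponent `≥ o − p` and `i`-exponent `≥ α_i`. [folklore] [cite: HauserPerlega2019PRIMS, §2] -/
theorem slice_step_lower (hjφ : j ≠ φ) (hjν : j ≠ ν) (hφν : φ ≠ ν) (hji : j ≠ i) (hiφ : i ≠ φ)
    (hν : ∀ d ∈ G.support, d ν = v) (ho : ∀ d ∈ G.support, o ≤ d.degree) (hαi : ∀ d ∈ G.support, αi ≤ d i) :
    ∀ d' ∈ (chartTransform p Finset.univ j (Hauser2010.shear j (Pi.single φ t) G)).support,
      d' ν = v ∧ o - p ≤ d' j ∧ αi ≤ d' i := by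
  intro d' hd'
  obtain ⟨e, he, rfl⟩ := Mode0Umbrella.exists_of_mem_support_chartTransform hd'
  obtain ⟨m, hm, l, hl, rfl⟩ := exists_of_mem_support_shear_single hjφ t G he
  have hdeg : ((m.update φ (m φ - l)).update j (m j + l)).degree = m.degree := degree_shear_target hjφ m hl
  have hom := ho m hm
  refine ⟨?_, ?_, ?_⟩
  · rw [chartExponent_apply_of_ne p Finset.univ hjν.symm, Finsupp.coe_update, Function.update_of_ne hjν.symm, Finsupp.coe_update,
      Function.update_of_ne hφν.symm, hν m hm]
  · rw [chartExponent_apply_self, degIn_univ, hdeg]; omega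
  · rw [chartExponent_apply_of_ne p Finset.univ hji.symm, Finsupp.coe_update, Function.update_of_ne hji.symm, Finsupp.coe_update,
      Function.update_of_ne hiφ]
    exact hαi m hm

/-- **THE TOP-`φ` MONOMIAL OF MINIMAL DEGREE SURVIVES**: the child has a monomial with `j`-exponent EXACTLY `o − p` and degree
`≤ 2o − p − α_j` — so the minimal `j`-exponent of the child is `o − p`, and the child's order is `≤ 2o − p − α_j` (the cofactor order
never increases). [folklore] [cite: Hauser2010, §F (multiplicity of the strict transform)] -/
theorem slice_step_top (hjφ : j ≠ φ) (ho : ∀ d ∈ G.support, o ≤ d.degree) (ho' : ∃ d ∈ G.support, d.degree = o)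
    (hαj : ∀ d ∈ G.support, αj ≤ d j) (hpo : p ≤ o) :
    ∃ d' ∈ (chartTransform p Finset.univ j (Hauser2010.shear j (Pi.single φ t) G)).support,
      d' j = o - p ∧ d'.degree + αj ≤ 2 * o - p := by
  classical
  -- the degree-`o` monomials, and their top-`φ` member
  set S : Finset (Fin 4 →₀ ℕ) := G.support.filter fun d => d.degree = o with hS
  have hSne : S.Nonempty := by
    obtain ⟨d, hd, hdo⟩ := ho'
    exact ⟨d, Finset.mem_filter.mpr ⟨hd, hdo⟩⟩
  obtain ⟨m, hm, htop⟩ := Finset.exists_max_image S (fun d => d φ) hSne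
  have hmG : m ∈ G.support := (Finset.mem_filter.mp hm).1
  have hmo : m.degree = o := (Finset.mem_filter.mp hm).2
  have hsurv : coeff m (Hauser2010.shear j (Pi.single φ t) G) ≠ 0 := by
    refine coeff_shear_single_ne_zero_of_top hjφ t G (Finset.filter_subset _ _) hm htop fun l hl1 hlj hmem => ?_
    refine Finset.mem_filter.mpr ⟨hmem, ?_⟩
    rw [degree_canceller hjφ m hlj, hmo]
  have hdegs : ∀ d ∈ (Hauser2010.shear j (Pi.single φ t) G).support, p ≤ d.degree := by
    intro d hd
    obtain ⟨m', hm', l, hl, rfl⟩ := exists_of_mem_support_shear_single hjφ t G hd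
    rw [degree_shear_target hjφ m' hl]
    exact hpo.trans (ho m' hm')
  refine ⟨chartExponent p Finset.univ j m, ?_, ?_, ?_⟩
  · rw [MvPolynomial.mem_support_iff, coeff_cT_chartExponent hdegs (by rw [hmo]; exact hpo)]
    exact hsurv
  · rw [chartExponent_apply_self, degIn_univ, hmo]
  · have h := degree_chartExponent_univ p j (e := m) (by rw [hmo]; exact hpo)
    have := hαj m hmG
    omega

/-- **THE OTHER TWIN'S MINIMUM IS ATTAINED AFTER THE STEP**: the child has a monomial with `i`-exponent `α_i` (the top-`φ` monomial among
those with `i`-exponent `α_i` survives). [folklore] [cite: Hauser2010, §I (P⁺)] -/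
theorem slice_step_other (hjφ : j ≠ φ) (hji : j ≠ i) (hiφ : i ≠ φ) (ho : ∀ d ∈ G.support, o ≤ d.degree)
    (hαi' : ∃ d ∈ G.support, d i = αi) (hpo : p ≤ o) :
    ∃ d' ∈ (chartTransform p Finset.univ j (Hauser2010.shear j (Pi.single φ t) G)).support, d' i = αi := by
  classical
  set S : Finset (Fin 4 →₀ ℕ) := G.support.filter fun d => d i = αi with hS
  have hSne : S.Nonempty := by
    obtain ⟨d, hd, hdi⟩ := hαi'
    exact ⟨d, Finset.mem_filter.mpr ⟨hd, hdi⟩⟩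
  obtain ⟨m, hm, htop⟩ := Finset.exists_max_image S (fun d => d φ) hSne
  have hmG : m ∈ G.support := (Finset.mem_filter.mp hm).1
  have hmi : m i = αi := (Finset.mem_filter.mp hm).2
  have hsurv : coeff m (Hauser2010.shear j (Pi.single φ t) G) ≠ 0 := by
    refine coeff_shear_single_ne_zero_of_top hjφ t G (Finset.filter_subset _ _) hm htop fun l hl1 hlj hmem => ?_
    refine Finset.mem_filter.mpr ⟨hmem, ?_⟩
    rw [Finsupp.coe_update, Function.update_of_ne hiφ, Finsupp.coe_update, Function.update_of_ne hji.symm, hmi]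
  have hdegs : ∀ d ∈ (Hauser2010.shear j (Pi.single φ t) G).support, p ≤ d.degree := by
    intro d hd
    obtain ⟨m', hm', l, hl, rfl⟩ := exists_of_mem_support_shear_single hjφ t G hd
    rw [degree_shear_target hjφ m' hl]
    exact hpo.trans (ho m' hm')
  refine ⟨chartExponent p Finset.univ j m, ?_, ?_⟩
  · rw [MvPolynomial.mem_support_iff, coeff_cT_chartExponent hdegs ((ho m hmG).trans' hpo)]
    exact hsurv
  · rw [chartExponent_apply_of_ne p Finset.univ hji.symm, hmi]

end Step

/-! ## 3. A non-increasing sequence of naturals is eventually constant -/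

/-- A sequence of naturals that never increases from `K₀` on is eventually constant. [folklore] -/
theorem eventually_constant_of_antitone {e : ℕ → ℕ} {K₀ : ℕ} (h : ∀ k, K₀ ≤ k → e (k + 1) ≤ e k) :
    ∃ K₁, K₀ ≤ K₁ ∧ ∀ k, K₁ ≤ k → e k = e K₁ := by
  -- strong induction on the value `e K₀`
  suffices H : ∀ n K, (∀ k, K ≤ k → e (k + 1) ≤ e k) → e K ≤ n → ∃ K₁, K ≤ K₁ ∧ ∀ k, K₁ ≤ k → e k = e K₁ from
    H (e K₀) K₀ h le_rfl
  intro n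
  induction n with
  | zero =>
    intro K hK h0
    refine ⟨K, le_rfl, fun k hk => ?_⟩
    have hmono : ∀ k, K ≤ k → e k ≤ e K := by
      intro k hk
      induction k, hk using Nat.le_induction with
      | base => exact le_rfl
      | succ k hk ih => exact (hK k hk).trans ih
    have := hmono k hk
    omega
  | succ n ih =>
    intro K hK hle
    by_cases hconst : ∀ k, K ≤ k → e k = e K
    · exact ⟨K, le_rfl, hconst⟩
    · push Not at hconst
      obtain ⟨k, hk, hne⟩ := hconst
      have hmono : ∀ k, K ≤ k → e k ≤ e K := by
        intro k hk
        induction k, hk using Nat.le_induction with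
        | base => exact le_rfl
        | succ k hk ih => exact (hK k hk).trans ih
      have hlt : e k ≤ n := by have := hmono k hk; omega
      obtain ⟨K₁, hK₁, hc⟩ := ih k (fun k' hk' => hK k' (hk.trans hk')) hlt
      exact ⟨K₁, hk.trans hK₁, hc⟩

/-! ## 4. The corner dynamics on `ℤ²`: the trichotomy -/

section Corner

variable {u w : ℕ → ℤ} {isA : ℕ → Prop} {K₀ : ℕ}

/-- **THE CORNER-DYNAMICS TRICHOTOMY** (integer form).  A pair `(u_k, w_k)` that moves by `(u, w) ↦ (u + w, w)` at `A`-times and by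
`(u, w) ↦ (u, u + w)` at the other times, with both kinds of time beyond every time and `u + w` bounded below, is either IDENTICALLY
`(0, 0)` from `K₀` on or has `u_k + w_k → +∞`.  (Mixed strict signs for ever are impossible: `|u| + |w|` would strictly decrease at every
step; both `≤ 0` and not both `0` makes `u + w → −∞`.) [folklore] [cite: CossartJannsenSaito2020, Lemma 13.2] -/
theorem corner_trichotomy (hA : ∀ k, K₀ ≤ k → isA k → u (k + 1) = u k + w k ∧ w (k + 1) = w k)
    (hB : ∀ k, K₀ ≤ k → ¬ isA k → w (k + 1) = u k + w k ∧ u (k + 1) = u k)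
    (hAio : ∀ N, ∃ k, N ≤ k ∧ isA k) (hBio : ∀ N, ∃ k, N ≤ k ∧ ¬ isA k)
    {M : ℤ} (hbdd : ∀ k, K₀ ≤ k → M ≤ u k + w k) :
    (∀ k, K₀ ≤ k → u k = 0 ∧ w k = 0) ∨ ∀ N : ℤ, ∃ K₁, ∀ k, K₁ ≤ k → N ≤ u k + w k := by
  classical
  -- (ii) both `≥ 0`, not both `0`, at some time ⇒ divergence to `+∞`
  have grow : ∀ k₀, K₀ ≤ k₀ → 0 ≤ u k₀ → 0 ≤ w k₀ → (u k₀ ≠ 0 ∨ w k₀ ≠ 0) →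
      ∀ N : ℤ, ∃ K₁, ∀ k, K₁ ≤ k → N ≤ u k + w k := by
    intro k₀ hk₀ hu hw hne
    -- from `k₀` on both coordinates stay `≥ 0` and are non-decreasing
    have hmono : ∀ k, k₀ ≤ k → 0 ≤ u k ∧ 0 ≤ w k ∧ u k₀ ≤ u k ∧ w k₀ ≤ w k := by
      intro k hk
      induction k, hk using Nat.le_induction with
      | base => exact ⟨hu, hw, le_rfl, le_rfl⟩
      | succ k hk ih =>
        by_cases ha : isA k
        · obtain ⟨h1, h2⟩ := hA k (by omega) ha; rw [h1, h2]; exact ⟨by omega, ih.2.1, by omega, ih.2.2.2⟩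
        · obtain ⟨h1, h2⟩ := hB k (by omega) ha; rw [h1, h2]; exact ⟨ih.1, by omega, ih.2.2.1, by omega⟩
    -- a time from which on both coordinates are `≥ 1`
    have hboth : ∃ k₁, k₀ ≤ k₁ ∧ 1 ≤ u k₁ ∧ 1 ≤ w k₁ := by
      rcases hne with hne | hne
      · obtain ⟨k, hk, hkB⟩ := hBio k₀
        obtain ⟨h1, h2⟩ := hB k (by omega) hkB
        have := hmono k hk
        exact ⟨k + 1, by omega, by rw [h2]; omega, by rw [h1]; omega⟩
      · obtain ⟨k, hk, hkA⟩ := hAio k₀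
        obtain ⟨h1, h2⟩ := hA k (by omega) hkA
        have := hmono k hk
        exact ⟨k + 1, by omega, by rw [h1]; omega, by rw [h2]; omega⟩
    obtain ⟨k₁, hk₁, hu1, hw1⟩ := hboth
    -- from `k₁` on the sum grows by at least one per step
    have hlin : ∀ k, k₁ ≤ k → 1 ≤ u k ∧ 1 ≤ w k ∧ (k : ℤ) - k₁ + 2 ≤ u k + w k := by
      intro k hk
      induction k, hk using Nat.le_induction with
      | base => exact ⟨hu1, hw1, by omega⟩
      | succ k hk ih =>
        by_cases ha : isA k
        · obtain ⟨h1, h2⟩ := hA k (by omega) ha; rw [h1, h2]; push_cast; exact ⟨by omega, ih.2.1, by omega⟩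
        · obtain ⟨h1, h2⟩ := hB k (by omega) ha; rw [h1, h2]; push_cast; exact ⟨ih.1, by omega, by omega⟩
    intro N
    refine ⟨k₁ + N.toNat, fun k hk => ?_⟩
    have := (hlin k (by omega)).2.2
    have hN := Int.self_le_toNat N
    omega
  -- (iii) both `≤ 0`, not both `0`, at some time ⇒ the sum → `−∞`, impossible
  have die : ∀ k₀, K₀ ≤ k₀ → u k₀ ≤ 0 → w k₀ ≤ 0 → (u k₀ ≠ 0 ∨ w k₀ ≠ 0) → False := by
    intro k₀ hk₀ hu hw hne
    have hmono : ∀ k, k₀ ≤ k → u k ≤ 0 ∧ w k ≤ 0 ∧ u k ≤ u k₀ ∧ w k ≤ w k₀ := by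
      intro k hk
      induction k, hk using Nat.le_induction with
      | base => exact ⟨hu, hw, le_rfl, le_rfl⟩
      | succ k hk ih =>
        by_cases ha : isA k
        · obtain ⟨h1, h2⟩ := hA k (by omega) ha; rw [h1, h2]; exact ⟨by omega, ih.2.1, by omega, ih.2.2.2⟩
        · obtain ⟨h1, h2⟩ := hB k (by omega) ha; rw [h1, h2]; exact ⟨ih.1, by omega, by omega, by omega⟩
    have hboth : ∃ k₁, k₀ ≤ k₁ ∧ u k₁ ≤ -1 ∧ w k₁ ≤ -1 := by
      rcases hne with hne | hne
      · obtain ⟨k, hk, hkB⟩ := hBio k₀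
        obtain ⟨h1, h2⟩ := hB k (by omega) hkB
        have := hmono k hk
        exact ⟨k + 1, by omega, by rw [h2]; omega, by rw [h1]; omega⟩
      · obtain ⟨k, hk, hkA⟩ := hAio k₀
        obtain ⟨h1, h2⟩ := hA k (by omega) hkA
        have := hmono k hk
        exact ⟨k + 1, by omega, by rw [h1]; omega, by rw [h2]; omega⟩
    obtain ⟨k₁, hk₁, hu1, hw1⟩ := hboth
    have hlin : ∀ k, k₁ ≤ k → u k ≤ -1 ∧ w k ≤ -1 ∧ u k + w k ≤ (k₁ : ℤ) - k - 2 := by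
      intro k hk
      induction k, hk using Nat.le_induction with
      | base => exact ⟨hu1, hw1, by omega⟩
      | succ k hk ih =>
        by_cases ha : isA k
        · obtain ⟨h1, h2⟩ := hA k (by omega) ha; rw [h1, h2]; push_cast; exact ⟨by omega, ih.2.1, by omega⟩
        · obtain ⟨h1, h2⟩ := hB k (by omega) ha; rw [h1, h2]; push_cast; exact ⟨ih.1, by omega, by omega⟩
    have h1 := (hlin (k₁ + (k₁ + 2 + (-M).toNat : ℤ).toNat) (by omega)).2.2
    have h2 := hbdd (k₁ + (k₁ + 2 + (-M).toNat : ℤ).toNat) (by omega)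
    have h3 := Int.self_le_toNat (-M)
    push_cast at h1
    omega
  -- the case split
  by_cases hpos : ∃ k₀, K₀ ≤ k₀ ∧ 0 ≤ u k₀ ∧ 0 ≤ w k₀ ∧ (u k₀ ≠ 0 ∨ w k₀ ≠ 0)
  · obtain ⟨k₀, hk₀, hu, hw, hne⟩ := hpos
    exact Or.inr (grow k₀ hk₀ hu hw hne)
  by_cases hneg : ∃ k₀, K₀ ≤ k₀ ∧ u k₀ ≤ 0 ∧ w k₀ ≤ 0 ∧ (u k₀ ≠ 0 ∨ w k₀ ≠ 0)
  · obtain ⟨k₀, hk₀, hu, hw, hne⟩ := hneg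
    exact (die k₀ hk₀ hu hw hne).elim
  push Not at hpos hneg
  -- now at every time: `(0,0)` or strictly mixed signs
  by_cases h0 : u K₀ = 0 ∧ w K₀ = 0
  · left
    intro k hk
    induction k, hk using Nat.le_induction with
    | base => exact h0
    | succ k hk ih =>
      by_cases ha : isA k
      · obtain ⟨h1, h2⟩ := hA k hk ha; rw [h1, h2, ih.1, ih.2]; simp
      · obtain ⟨h1, h2⟩ := hB k hk ha; rw [h1, h2, ih.1, ih.2]; simp
  · exfalso
    -- strictly mixed signs for ever: `|u| + |w|` drops at every step
    have hmixed : ∀ k, K₀ ≤ k → ¬ (u k = 0 ∧ w k = 0) → (0 < u k ∧ w k < 0) ∨ (u k < 0 ∧ 0 < w k) := by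
      intro k hk hnz
      have h1 := hpos k hk
      have h2 := hneg k hk
      by_cases hu : 0 ≤ u k
      · by_cases hw : 0 ≤ w k
        · exact absurd (h1 hu hw) (by tauto)
        · push Not at hw
          rcases (lt_or_eq_of_le hu) with hu' | hu'
          · exact Or.inl ⟨hu', hw⟩
          · exact absurd (h2 (by omega) hw.le) (by omega)
      · push Not at hu
        by_cases hw : 0 < w k
        · exact Or.inr ⟨hu, hw⟩
        · push Not at hw
          exact absurd (h2 hu.le hw) (by omega)
    have hdrop : ∀ k, K₀ ≤ k → ¬ (u k = 0 ∧ w k = 0) →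
        ¬ (u (k + 1) = 0 ∧ w (k + 1) = 0) ∧ |u (k + 1)| + |w (k + 1)| + 1 ≤ |u k| + |w k| := by
      intro k hk hnz
      have hm := hmixed k hk hnz
      have hnz' : ¬ (u (k + 1) = 0 ∧ w (k + 1) = 0) := by
        intro h
        by_cases ha : isA k
        · obtain ⟨h1, h2⟩ := hA k hk ha; rw [h1, h2] at h; omega
        · obtain ⟨h1, h2⟩ := hB k hk ha; rw [h1, h2] at h; omega
      refine ⟨hnz', ?_⟩
      have hm' := hmixed (k + 1) (by omega) hnz'
      by_cases ha : isA k
      · obtain ⟨h1, h2⟩ := hA k hk ha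
        rw [h1, h2] at hm' ⊢
        rcases hm with ⟨hu, hw⟩ | ⟨hu, hw⟩ <;> rcases hm' with ⟨hu', hw'⟩ | ⟨hu', hw'⟩ <;>
          simp only [abs_of_pos, abs_of_neg, hu, hw, hu', hw'] <;> omega
      · obtain ⟨h1, h2⟩ := hB k hk ha
        rw [h1, h2] at hm' ⊢
        rcases hm with ⟨hu, hw⟩ | ⟨hu, hw⟩ <;> rcases hm' with ⟨hu', hw'⟩ | ⟨hu', hw'⟩ <;>
          simp only [abs_of_pos, abs_of_neg, hu, hw, hu', hw'] <;> omega
    -- descend `|u| + |w|` below zero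
    have hdesc : ∀ (n : ℕ) k, K₀ ≤ k → ¬ (u k = 0 ∧ w k = 0) → |u k| + |w k| ≤ (n : ℤ) → False := by
      intro n
      induction n with
      | zero => intro k hk hnz hle; apply hnz; constructor <;> [exact abs_nonpos_iff.mp (by have := abs_nonneg (w k); omega);
          exact abs_nonpos_iff.mp (by have := abs_nonneg (u k); omega)]
      | succ n ih =>
        intro k hk hnz hle
        obtain ⟨hnz', hd⟩ := hdrop k hk hnz
        exact ih (k + 1) (by omega) hnz' (by push_cast at hle ⊢; omega)
    exact hdesc (|u K₀| + |w K₀|).toNat K₀ le_rfl h0 (Int.self_le_toNat _)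

end Corner

end LLight

end ResCone

end Summit.ResolutionOfSingularities.ResolutionOfSingularities.Theorems.PIDim4

end
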